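import Mathlib
import Summits.Ventures.FusionMHD.Models.SolovevMercierAxisRegularLimit
import Summits.Ventures.FusionMHD.Models.SolovevMercierAxisRegularAxisValue
import HarnessLib

/-!
# Axis-regular Mercier slope/intercept on the Lee–Cerfon / PCF Solov'ev family — §8: NEAR THE AXIS THE FLUX-SURFACE
# MERCIER CRITERION (Jardin (8.134)) IS DECIDED BY BATEMAN'S NEAR-AXIS CRITERION (7.3.2) (strict cases), and the
# threshold converges to the closed form `(F_B/q₀)·√(κ(κ+1)(κ²+1)/(2(κ²+3κ−2)))`

Fifth file of the `SolovevMercierAxisRegular*` set (gridfusion-model-7 (g4), LADDER-GRIDFUSION rung F1.MERCIER, 2026-08-27);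
combines `…Limit.lean` (continuity of `N₂, N₀` on `[0, R₀/2)`, `tendsto_lcMercierThreshold_axis`) with `…AxisValue.lean`
(closed forms at `r = 0`, `regular_axis_iff_nearAxis`).  For every member `κ, F_B, R₀, q₀ > 0`, shift `a`, toroidal
constant `g > 0`, with `q_axis(g) = (g/F_B)q₀` and `e = κ` the model's own on-axis safety factor and elongation
(`axisData_lc`):
* `axis_margin_eq` — `g²N₂(0) − N₀(0) = [4π²κF_B²(κ²+1)²g²/(R₀¹⁴q₀²)]·(bound κ 0 0 1 − 1/q_axis(g)²)`: the regular
  margin at the axis is a POSITIVE multiple of Bateman's margin;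
* **`eventually_mercierCriterion_of_nearAxis`** (and `eventually_forall_…`, uniform in `g ≥ G`) — if Bateman's near-axis
  Mercier criterion holds (strictly, as typed: `1/q_axis² < bound`), then the flux-surface Mercier criterion (8.134) holds on
  EVERY surface sufficiently close to the axis (`∀ᶠ r in 𝓝[>] 0`); **`eventually_not_mercierCriterion_of_nearAxis_lt`** — if it fails strictly
  (`bound < 1/q_axis²`), (8.134) FAILS on every surface sufficiently close to the axis.  This is the rigorous content, for
  this family, of «(7.3.2) is the near-axis limit of Mercier's criterion» (not asserted in general in `MercierNearAxis.lean`);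
* `mercierCriterion_wholeProfile_of_regular` — the WHOLE-PROFILE glue: `N₀ < G²N₂` on `(0, rₑ]` ⇒ (8.134) on every
  surface `0 < r ≤ rₑ` for every `g ≥ G`;
* `tendsto_lcMercierThreshold_axis_closedForm` — for `κ² + 3κ > 2`:
  `g_M(r) → √(F_B²κ(κ+1)(κ²+1)/(2q₀²(κ²+3κ−2)))` as `r → 0⁺` (= `0.6190279941…` on the ITER-like PCF instance, the
  certified Bateman axis row — now a LIMIT THEOREM, no longer a cross-check of two printed criteria).
HONEST FRAMING: exact real analysis about MODEL objects (ideal MHD, analytic fixed-boundary Solov'ev family, `FF′ = 0`,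
Bateman's `Q = 0`, `d = 0`); both criteria are NECESSARY local-interchange conditions; nothing here is a stability claim,
an enclosure or an instance.  Sources: [bib `Jardin2010`] (8.134), [bib `Bateman1978`] (7.3.2), [bib `LeeCerfon2015`] §4.1.
-/

noncomputable section

open Real Set MeasureTheory intervalIntegral Filter Topology
open Literature.MathematicalPhysics.MHD Literature.MathematicalPhysics.MHD.Solovev
open Literature.MathematicalPhysics.MHD.GradShafranov

namespace Summit.Ventures.FusionMHD.Models

namespace LcMercierRegular

section nearaxis

variable {κ FB R₀ q₀ : ℝ} (hR₀ : 0 < R₀) (hκ : 0 < κ) (hFB : 0 < FB) (hq₀ : 0 < q₀)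
include hR₀ hκ hFB hq₀

/-- **The axis margin is a positive multiple of Bateman's margin:**
`g²N₂(0) − N₀(0) = [4π²κF_B²(κ²+1)²g²/(R₀¹⁴q₀²)]·(bound κ 0 0 1 − 1/((g/F_B)q₀)²)` (`g ≠ 0`).
[cite: Bateman1978, §7.3 eq. (7.3.2)] -/
theorem axis_margin_eq {g : ℝ} (hg : g ≠ 0) :
    g ^ 2 * lcRegSlopeNum κ FB R₀ q₀ 0 - lcRegInterceptNum κ FB R₀ q₀ 0
      = 4 * π ^ 2 * κ * FB ^ 2 * (κ ^ 2 + 1) ^ 2 * g ^ 2 / (R₀ ^ 14 * q₀ ^ 2)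
          * (Mercier.NearAxis.bound κ 0 0 1 - 1 / (g * q₀ / FB) ^ 2) := by
  obtain ⟨h2, h0⟩ := lcRegNum_axis hR₀ hκ hFB hq₀
  have hR := hR₀.ne'; have hk := hκ.ne'; have hF := hFB.ne'; have hq := hq₀.ne'
  have hk1 : κ + 1 ≠ 0 := by positivity
  have hk2 : 1 + κ ^ 2 ≠ 0 := by positivity
  rw [h2, h0]
  unfold Mercier.NearAxis.bound
  field_simp
  ring

/-- The regular margin stays positive near the axis when Bateman's criterion holds strictly at `G`:
`∀ᶠ r → 0⁺: r ∈ (0, R₀/2) ∧ N₀(r) < G²·N₂(r)`. [cite: Bateman1978, §7.3 eq. (7.3.2)] -/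
theorem eventually_regular_of_nearAxis {G : ℝ} (hG : 0 < G)
    (h : Mercier.NearAxis.MercierCriterion (G * q₀ / FB) κ 0 0) :
    ∀ᶠ r in 𝓝[>] (0 : ℝ), r ∈ Ioo 0 (R₀ / 2)
      ∧ lcRegInterceptNum κ FB R₀ q₀ r < G ^ 2 * lcRegSlopeNum κ FB R₀ q₀ r := by
  have h0 : lcRegInterceptNum κ FB R₀ q₀ 0 < G ^ 2 * lcRegSlopeNum κ FB R₀ q₀ 0 :=
    (regular_axis_iff_nearAxis hR₀ hκ hFB hq₀ hG.ne').2 h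
  obtain ⟨c2, c0⟩ := continuousOn_lcRegNum (κ := κ) (FB := FB) (q₀ := q₀) hR₀ hκ
  have hR2 : (0 : ℝ) < R₀ / 2 := by positivity
  have hmem : (0 : ℝ) ∈ Ico 0 (R₀ / 2) := ⟨le_rfl, hR2⟩
  have hφ : ContinuousWithinAt (fun r => G ^ 2 * lcRegSlopeNum κ FB R₀ q₀ r - lcRegInterceptNum κ FB R₀ q₀ r)
      (Ico 0 (R₀ / 2)) 0 := ((c2 0 hmem).const_smul (G ^ 2)).sub (c0 0 hmem)
  have hev : ∀ᶠ r in 𝓝[Ico 0 (R₀ / 2)] (0 : ℝ),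
      0 < G ^ 2 * lcRegSlopeNum κ FB R₀ q₀ r - lcRegInterceptNum κ FB R₀ q₀ r :=
    hφ.tendsto.eventually_const_lt (sub_pos.2 h0)
  have hev' : ∀ᶠ r in 𝓝[>] (0 : ℝ), 0 < G ^ 2 * lcRegSlopeNum κ FB R₀ q₀ r - lcRegInterceptNum κ FB R₀ q₀ r := by
    have := hev.filter_mono (nhdsWithin_mono 0 (Ioo_subset_Ico_self : Ioo 0 (R₀ / 2) ⊆ Ico 0 (R₀ / 2)))
    rwa [nhdsWithin_Ioo_eq_nhdsGT hR2] at this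
  filter_upwards [hev', Ioo_mem_nhdsGT hR2] with r hr hI
  exact ⟨hI, sub_pos.1 hr⟩

/-- **Near-axis Mercier (strict) ⇒ flux-surface Mercier on every surface close enough to the axis, UNIFORMLY in the free
constant:** if Bateman's criterion `1/q_axis(G)² < 6/(1+κ²) − 4/(κ(κ+1))` holds for the field with toroidal constant
`G > 0`, then for all sufficiently small `r > 0` the surface `r` of `Ψ = psiLC κ F_B R₀ q₀ a` satisfies Jardin's flux-surface
Mercier criterion (8.134) for EVERY `g ≥ G`. [cite: Bateman1978, §7.3 eq. (7.3.2)] -/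
theorem eventually_forall_mercierCriterion_of_nearAxis (a : ℝ) {G : ℝ} (hG : 0 < G)
    (h : Mercier.NearAxis.MercierCriterion (G * q₀ / FB) κ 0 0) :
    ∀ᶠ r in 𝓝[>] (0 : ℝ), ∀ g, G ≤ g → (lcGGJData κ FB R₀ q₀ a g r).MercierCriterion := by
  filter_upwards [eventually_regular_of_nearAxis hR₀ hκ hFB hq₀ hG h] with r hr g hg
  exact mercierCriterion_lcGGJData_of_regular hR₀ hκ hFB hq₀ hr.1.1 (by linarith [hr.1.2]) hG.le hg hr.2

/-- **Near-axis Mercier (strict) ⇒ flux-surface Mercier on every surface close enough to the axis** (the case `g = G`).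
[cite: Bateman1978, §7.3 eq. (7.3.2)] -/
theorem eventually_mercierCriterion_of_nearAxis (a : ℝ) {g : ℝ} (hg : 0 < g)
    (h : Mercier.NearAxis.MercierCriterion (g * q₀ / FB) κ 0 0) :
    ∀ᶠ r in 𝓝[>] (0 : ℝ), (lcGGJData κ FB R₀ q₀ a g r).MercierCriterion := by
  filter_upwards [eventually_forall_mercierCriterion_of_nearAxis hR₀ hκ hFB hq₀ a hg h] with r hr
  exact hr g le_rfl

/-- **Near-axis Mercier violated (strictly) ⇒ flux-surface Mercier fails on every surface close enough to the axis.**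
[cite: Bateman1978, §7.3 eq. (7.3.2)] -/
theorem eventually_not_mercierCriterion_of_nearAxis_lt (a : ℝ) {g : ℝ} (hg : 0 < g)
    (h : Mercier.NearAxis.bound κ 0 0 1 < 1 / (g * q₀ / FB) ^ 2) :
    ∀ᶠ r in 𝓝[>] (0 : ℝ), ¬ (lcGGJData κ FB R₀ q₀ a g r).MercierCriterion := by
  have hC : 0 < 4 * π ^ 2 * κ * FB ^ 2 * (κ ^ 2 + 1) ^ 2 * g ^ 2 / (R₀ ^ 14 * q₀ ^ 2) := by positivity
  have h0 : g ^ 2 * lcRegSlopeNum κ FB R₀ q₀ 0 - lcRegInterceptNum κ FB R₀ q₀ 0 < 0 := by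
    rw [axis_margin_eq hR₀ hκ hFB hq₀ hg.ne']
    exact mul_neg_of_pos_of_neg hC (sub_neg.2 h)
  obtain ⟨c2, c0⟩ := continuousOn_lcRegNum (κ := κ) (FB := FB) (q₀ := q₀) hR₀ hκ
  have hR2 : (0 : ℝ) < R₀ / 2 := by positivity
  have hmem : (0 : ℝ) ∈ Ico 0 (R₀ / 2) := ⟨le_rfl, hR2⟩
  have hφ : ContinuousWithinAt (fun r => g ^ 2 * lcRegSlopeNum κ FB R₀ q₀ r - lcRegInterceptNum κ FB R₀ q₀ r)
      (Ico 0 (R₀ / 2)) 0 := ((c2 0 hmem).const_smul (g ^ 2)).sub (c0 0 hmem)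
  have hev : ∀ᶠ r in 𝓝[Ico 0 (R₀ / 2)] (0 : ℝ),
      g ^ 2 * lcRegSlopeNum κ FB R₀ q₀ r - lcRegInterceptNum κ FB R₀ q₀ r < 0 :=
    hφ.tendsto.eventually_lt_const h0
  have hev' : ∀ᶠ r in 𝓝[>] (0 : ℝ), g ^ 2 * lcRegSlopeNum κ FB R₀ q₀ r - lcRegInterceptNum κ FB R₀ q₀ r < 0 := by
    have := hev.filter_mono (nhdsWithin_mono 0 (Ioo_subset_Ico_self : Ioo 0 (R₀ / 2) ⊆ Ico 0 (R₀ / 2)))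
    rwa [nhdsWithin_Ioo_eq_nhdsGT hR2] at this
  filter_upwards [hev', Ioo_mem_nhdsGT hR2] with r hr hI
  exact not_mercierCriterion_lcGGJData_of_regular hR₀ hκ hFB hq₀ hI.1 (by linarith [hI.2]) (by linarith)

/-- The same two statements in the model's own axis vocabulary (`safetyFactorOnAxis`, `elongationOnAxis` of `Ψ = psiLC`).
[cite: Bateman1978, §7.3 eq. (7.3.2)] -/
theorem eventually_mercierCriterion_model (a : ℝ) {g : ℝ} (hg : 0 < g) :
    (Mercier.NearAxis.MercierCriterion
        (safetyFactorOnAxis g R₀ (dRR (psiLC κ FB R₀ q₀ a) R₀ 0) (dZZ (psiLC κ FB R₀ q₀ a) R₀ 0))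
        (elongationOnAxis (dRR (psiLC κ FB R₀ q₀ a) R₀ 0) (dZZ (psiLC κ FB R₀ q₀ a) R₀ 0)) 0 0
      → ∀ᶠ r in 𝓝[>] (0 : ℝ), (lcGGJData κ FB R₀ q₀ a g r).MercierCriterion)
    ∧ (Mercier.NearAxis.bound (elongationOnAxis (dRR (psiLC κ FB R₀ q₀ a) R₀ 0) (dZZ (psiLC κ FB R₀ q₀ a) R₀ 0)) 0 0 1
          < 1 / safetyFactorOnAxis g R₀ (dRR (psiLC κ FB R₀ q₀ a) R₀ 0) (dZZ (psiLC κ FB R₀ q₀ a) R₀ 0) ^ 2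
      → ∀ᶠ r in 𝓝[>] (0 : ℝ), ¬ (lcGGJData κ FB R₀ q₀ a g r).MercierCriterion) := by
  obtain ⟨hq, he⟩ := axisData_lc hR₀ hκ hFB hq₀ a g
  rw [hq, he]
  exact ⟨eventually_mercierCriterion_of_nearAxis hR₀ hκ hFB hq₀ a hg,
    eventually_not_mercierCriterion_of_nearAxis_lt hR₀ hκ hFB hq₀ a hg⟩

/-- **The near-axis limit of the flux-surface Mercier threshold in closed form:** for `κ² + 3κ > 2`,
`g_M(r) → √(F_B²κ(κ+1)(κ²+1)/(2q₀²(κ²+3κ−2)))` as `r → 0⁺` — the Bateman threshold `q_axis(g_M)⁻² = bound κ 0 0 1`.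
[cite: Jardin2010, §8.5.4 eq. (8.134)] -/
theorem tendsto_lcMercierThreshold_axis_closedForm (a : ℝ) (hκ2 : 2 < κ ^ 2 + 3 * κ) :
    Tendsto (fun r => lcMercierThreshold κ FB R₀ q₀ a r) (𝓝[>] 0)
      (𝓝 (Real.sqrt (FB ^ 2 * κ * (κ + 1) * (κ ^ 2 + 1) / (2 * q₀ ^ 2 * (κ ^ 2 + 3 * κ - 2))))) := by
  have hN2 : lcRegSlopeNum κ FB R₀ q₀ 0 ≠ 0 := ((lcRegSlopeNum_axis_pos_iff hR₀ hκ hFB hq₀).2 hκ2).ne'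
  have h := tendsto_lcMercierThreshold_axis hR₀ hκ hFB hq₀ a hN2
  rwa [lcRegRatio_axis hR₀ hκ hFB hq₀] at h

/-- **WHOLE-PROFILE GLUE.** If the regular cell inequality `N₀(r) < G²·N₂(r)` (`G ≥ 0`) has been certified for every
`r ∈ (0, rₑ]` (`2rₑ < R₀`) — e.g. cell by cell with `r` a box parameter, the first cell `[0, r₁]` containing the axis —
then Jardin's flux-surface Mercier criterion holds on EVERY surface `0 < r ≤ rₑ` of `Ψ = psiLC κ F_B R₀ q₀ a` for EVERY
toroidal constant `g ≥ G`. (MODELLED: ideal MHD, analytic fixed-boundary model; a NECESSARY-criterion statement.)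
[cite: Jardin2010, §8.5.4 eq. (8.134)] -/
theorem mercierCriterion_wholeProfile_of_regular (a : ℝ) {rₑ G : ℝ} (hre : 2 * rₑ < R₀) (hG : 0 ≤ G)
    (h : ∀ r ∈ Ioc 0 rₑ, lcRegInterceptNum κ FB R₀ q₀ r < G ^ 2 * lcRegSlopeNum κ FB R₀ q₀ r) :
    ∀ r ∈ Ioc 0 rₑ, ∀ g, G ≤ g → (lcGGJData κ FB R₀ q₀ a g r).MercierCriterion := fun r hr g hg =>
  mercierCriterion_lcGGJData_of_regular hR₀ hκ hFB hq₀ hr.1 (by linarith [hr.2]) hG hg (h r hr)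

end nearaxis

end LcMercierRegular

end Summit.Ventures.FusionMHD.Models

end
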